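import Literature.NumberTheory.Automorphic.Liu2021.AppendixC.EtaleH1TowerCMEigenline
import Literature.NumberTheory.ComplexMultiplication.ShimuraTaniyamaDualEigenline
import Literature.AlgebraicGeometry.ComplexMultiplication.PrincipalModelOfCMOrder
import Literature.NumberTheory.ComplexMultiplication.CMTypeRealisationTypeDetermined
import Literature.AlgebraicGeometry.Motives.AbelianVarietyEpiTateSurjective
import HarnessLib

/-!
# [Liu 2021, §D.4 l. 5626–5628] the CM step of Thm. D.6 (1) as ONE theorem: a quotient `A_K → B` of the Albanese tower with a
# RATIONAL CM structure `M → End⁰_E(B)` of full degree ⟹ arithmetic Frobenius acts on the transported `τ`-eigenlines of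
# `H¹_ét(A_∞)` by the inverse uniformiser value of the Shimura–Taniyama character

Topic `NumberTheory/Automorphic/Liu2021/AppendixC`; namespace `Literature.NumberTheory.Automorphic.Liu2021.AppendixC.Sec42Data`.
THEOREMS ONLY (no definition, no named fact, no instance, no `sorry`).  This file COMPOSES four landed theorems and proves nothing
new about Shimura curves:
* ★ `ComplexMultiplication.exists_principalModel` ([Shimura1998] §7.1 Prop. 7 over any field of characteristic `0`: a rational
  `O`-structure becomes INTEGRAL on an isogenous variety `B′`, with the isogeny `u : B ⟶ B′`, its quasi-inverse and the transport
  identity `End⁰(u) ∘ ψ = 1 ⊗ ρ`);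
* ★ `ComplexMultiplication.exists_cmType_isCMTypeRealisationOver` ([Shimura1998] §5.2 + §8.5 Prop. 30, TYPE-FREE: an integral
  structure `𝓞_M → End_E(B′)` of full degree `[M:ℚ] = 2 dim B′` realises a unique CM type OVER `E`);
* ★ `ComplexMultiplication.IsCMTypeRealisationOver.dual_rationalTateRep_eigenline_eventually_along` ([Shimura1998] Thm. 18.6 +
  19.11 / [SerreTate1968] §7: on the `(ι′ ∘ τ)`-eigenline of `R ⊗ (V_ℓ B′)^∨` arithmetic Frobenius at `v` acts by
  `(ι′ (χ_τ(ϖ_v)))⁻¹`, `χ` the Shimura–Taniyama family of `(B′, ρ)`);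
* ★ `Sec42Data.towerRep_baseChange_eq_smul_of_dual_eq_smul` ([Liu2021] §4.2: transport of an eigen-relation along
  `toTower K ∘ ᵗV_ℓ(φ ≫ u)` into `R ⊗ H¹_ét(A_∞)`).

## Statement (`exists_heckeCharacter_towerRep_eq_inv_smul_of_ringHom`)

Let `C : Sec42Data P5 isotropicAt` be a §4.2 datum over the CM extension `E/F`, `K` a small level, `B` an abelian variety over `E`,
`φ : C.A K ⟶ B` (e.g. a Hecke-isotypic quotient of `Alb X_K`), `M` a CM number field with a ring homomorphism
`i : M →+* End⁰_E(B)` and `[M : ℚ] = 2 dim B` («`B` has complex multiplications by `M`», l. 5627), and `E ⊂ ℂ` any complex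
embedding (`[Algebra E ℂ]`).  Then there are an `E`-isogeny `u : B ⟶ B′`, an INTEGRAL structure `ρ : 𝓞 M →+* End_E(B′)` transporting
`i`, a CM type `Φ` with `IsCMTypeRealisationOver Φ B′ ρ`, and a family `χ : (M →+* ℂ) → HeckeCharacter E` of infinity type
`cmInfinityType Φ τ`, such that for all `v` outside a FINITE set of places of `E`: if `ℓ ∤ v`, then for every `𝔓 ∣ v`, every
ARITHMETIC Frobenius `σ` at `𝔓`, every field `R ⊇ ℚ_ℓ` with `ι′ : ℂ →+* R`, every `τ : M →+* ℂ` and every `f ∈ R ⊗ (V_ℓ B′)^∨` on the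
`(ι′ ∘ τ)`-eigenline of the transposed `𝓞_M`-action,

  `(1 ⊗ towerRep σ) ((1 ⊗ (toTower K ∘ ᵗV_ℓ(φ ≫ u))) f) = (ι′ (χ_τ.valueAtUniformizer v))⁻¹ • (1 ⊗ (toTower K ∘ ᵗV_ℓ(φ ≫ u))) f`

— «`μ̃` is the associated CM character of `B₀`» in the registered normalisation of `thmD6OneCurveCUF` (cohomological, arithmetic
Frobenius, INVERSE uniformiser value).

DICTIONARY LINE (cell `hodgecm-mathlib`, crux `HLiu418` = stmt-HodgeConjecture-24832, d6 HOME card `A-plan/d6/D6-LINE-CARD.A-plan2g11.md`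
stub S2 `stub_d6_cmEigenChar`): with this theorem the S2 road reads «S1 (multiplicity one, [Liu2021] Prop. D.4 (1)) ⟹ a Hecke-isotypic
quotient `φ : C.A K ⟶ B` with `i : M →+* End⁰_E(B)` of full degree, `M` CM (simple factor), whose `ω⋆`-values are transported
`τ₀`-eigen-dual-Tate classes» followed by ONE application of `exists_heckeCharacter_towerRep_eq_inv_smul_of_ringHom`; the identity
`χ_{τ₀} = μ^{alg}` is the card's S3–S5.  The file moves no book (HC_CM is proved only modulo the 7 printed citations until rung 0 closes).

## Edition 2 (append-only): the `B`-side interface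

`exists_heckeCharacter_towerRep_eq_inv_smul_of_ringHom'` — the same conclusion with NO principal model in the statement: the
eigen-hypothesis is on `f ∈ R ⊗ (V_ℓ B)^∨` for the RATIONAL action `ᵗV_ℓ(i a)` (★ `AbelianVariety.rationalTateAction`), and the classes
are transported along `φ` itself; helpers `dualMap_baseChange_comp_of_comp_eq_nsmul`, `rationalTateAction_endAlgebraTransport`,
`dualMap_rationalTateAction_endAlgebraTransport_baseChange_eq_smul` (isogeny bookkeeping, [MumfordAV1970] §19 (p. 172)).

## References
* [Liu2021] Y. Liu, *Fourier–Jacobi cycles and arithmetic relative trace formula*, Camb. J. Math. 9 (2021): §4.2 (FJcycle.tex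
  l. 2066–2074, 2152–2165), App. D §D.4 (l. 5626–5628).
* [MumfordAV1970] D. Mumford, *Abelian Varieties* (1970), §19 (p. 172: quasi-inverse of an isogeny; `V_ℓ f`).
* [Shimura1998] G. Shimura, *Abelian Varieties with Complex Multiplication and Modular Functions* (1998): §7.1 Prop. 7 (p. 47),
  §5.2 (pp. 36–37), §8.5 Prop. 30, Thm. 18.6, Prop. 19.10, Thm. 19.11.
* [SerreTate1968] J.-P. Serre, J. Tate, *Good reduction of abelian varieties*, Ann. of Math. 88 (1968), §7 Thms. 10–11.
-/

set_option autoImplicit false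

noncomputable section

open CategoryTheory IsDedekindDomain NumberField
open scoped TensorProduct NumberField

namespace Literature.NumberTheory.Automorphic.Liu2021.AppendixC

open Literature.AlgebraicGeometry.Motives (AbelianVariety CMType)
open Literature.AlgebraicGeometry.Motives.AbelianVariety (IsIsogeny rationalTateModuleMap endAlgebraTransport
  dim_eq_of_isIsogeny)
open Literature.AlgebraicGeometry.ComplexMultiplication (exists_principalModel)
open Literature.NumberTheory.ComplexMultiplication
open Literature.NumberTheory.GaloisRepresentations

variable {F E : Type} [Field F] [NumberField F] [IsTotallyReal F] [Field E] [NumberField E] [Algebra F E]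
  [IsTotallyComplex E] [Algebra.IsQuadraticExtension F E]
variable {P5 : PropC5Data F E} {isotropicAt : ℕ → Prop}

namespace Sec42Data

variable (C : Sec42Data P5 isotropicAt) (ℓ : ℕ) [Fact ℓ.Prime]

/-- **The CM step of [Liu2021] Thm. D.6 (1), as one theorem** (see the module docstring for the statement in words): a quotient
`φ : A_K ⟶ B` with a RATIONAL CM structure `i : M →+* End⁰_E(B)` of full degree by a CM field `M` yields — on the principal model
`u : B ⟶ B′` of [Shimura1998] §7.1 Prop. 7 with its integral structure `ρ` and CM type `Φ` over `E` — the Shimura–Taniyama family `χ`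
and, for all `v` outside a finite set (`ℓ ∤ v`), the eigenvalue `(ι′ (χ_τ(ϖ_v)))⁻¹` of every arithmetic Frobenius at `v` on the
classes `(1 ⊗ (toTower K ∘ ᵗV_ℓ(φ ≫ u))) f`, `f` on the `(ι′ ∘ τ)`-eigenline of `R ⊗ (V_ℓ B′)^∨`.
[cite: Liu2021, App. D §D.4 (FJcycle.tex l. 5626–5628) and §4.2 (l. 2158–2165)] [cite: Shimura1998, §7.1 Proposition 7 (p. 47), §5.2, Thm. 18.6, Thm. 19.11] [cite: SerreTate1968, §7 Thm. 10 (c), Thm. 11] -/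
theorem exists_heckeCharacter_towerRep_eq_inv_smul_of_ringHom [Algebra E ℂ] (K : C5.SmallLevel C.S.K₀)
    {B : AbelianVariety E} (φ : C.A K ⟶ B) {M : Type} [Field M] [NumberField M] [IsCMField M]
    (i : M →+* B.endAlgebra) (hdim : Module.finrank ℚ M = 2 * B.dim) :
    ∃ (B' : AbelianVariety E) (u : B ⟶ B') (v : B' ⟶ B) (m : ℕ) (hm : 0 < m) (huv : u ≫ v = m • 𝟙 B)
      (hvu : v ≫ u = m • 𝟙 B') (ρ : 𝓞 M →+* End B') (Φ : CMType M) (χ : (M →+* ℂ) → HeckeCharacter E),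
      IsIsogeny u ∧
      (∀ a : 𝓞 M, endAlgebraTransport u v m hm huv hvu (i (a : M)) = AbelianVariety.endAlgebra.of B' (ρ a)) ∧
      IsCMTypeRealisationOver Φ B' ρ ∧
      (∀ τ : M →+* ℂ, (χ τ).HasInfinityType (cmInfinityType Φ.1 τ (algebraMap E ℂ)).1
        (cmInfinityType Φ.1 τ (algebraMap E ℂ)).2) ∧
      (∀ᶠ w : HeightOneSpectrum (𝓞 E) in Filter.cofinite, (ℓ : 𝓞 E) ∉ w.asIdeal →
        ∀ 𝔓 ∈ w.primesAbove, ∀ σ : Field.absoluteGaloisGroup E, IsArithFrobAt (𝓞 E) σ 𝔓 →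
          ∀ (R : Type) [Field R] [Algebra ℚ_[ℓ] R] (ι' : ℂ →+* R) (τ : M →+* ℂ)
            (f : R ⊗[ℚ_[ℓ]] Module.Dual ℚ_[ℓ] (B'.rationalTateModule ℓ)),
            (∀ x : 𝓞 M, ((rationalTateModuleMap ℓ (ρ x : B' ⟶ B')).dualMap).baseChange R f = ι' (τ (x : M)) • f) →
            (C.towerRep ℓ σ).baseChange R
                ((C.toTower ℓ K ∘ₗ (rationalTateModuleMap ℓ (φ ≫ u)).dualMap).baseChange R f) =
              (ι' ((χ τ).valueAtUniformizer w))⁻¹ •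
                (C.toTower ℓ K ∘ₗ (rationalTateModuleMap ℓ (φ ≫ u)).dualMap).baseChange R f) := by
  classical
  -- Shimura §7.1 Prop. 7: the principal model `B′` of the order `i(𝓞 M)`, over `E`
  let b := (RingOfIntegers.basis M).reindex (Fintype.equivFin (Module.Free.ChooseBasisIndex ℤ (𝓞 M)))
  obtain ⟨B', u, v, m, hm, huv, hvu, ρ, hu, hρ⟩ := exists_principalModel b (i.comp (algebraMap (𝓞 M) M))
  -- the type is determined: `(B′, ρ)` is a structure of some CM type `Φ` over `E`
  have hdim' : Module.finrank ℚ M = 2 * B'.dim := by rw [hdim, dim_eq_of_isIsogeny hu]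
  obtain ⟨Φ, hΦ⟩ := exists_cmType_isCMTypeRealisationOver hdim' ρ
  -- Shimura–Taniyama on the dual eigenline of `B′`
  obtain ⟨χ, h1, h5⟩ := hΦ.dual_rationalTateRep_eigenline_eventually_along Φ B' ρ
  refine ⟨B', u, v, m, hm, huv, hvu, ρ, Φ, χ, hu, fun a => hρ a, hΦ, h1, ?_⟩
  filter_upwards [h5] with w hw
  intro hℓ 𝔓 h𝔓 σ hσ R _ _ ι' τ f hf
  -- transport into the tower along `φ ≫ u`
  exact C.towerRep_baseChange_eq_smul_of_dual_eq_smul ℓ K (φ ≫ u) σ R _ f (hw ℓ hℓ 𝔓 h𝔓 σ hσ R ι' τ f hf)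

/-! ## §2 (edition 2, append-only) The `B`-side interface: eigenlines of the RATIONAL action on `(V_ℓ B)^∨`, classes along `φ` -/

section BSide

variable {C ℓ}

omit [NumberField E] [IsTotallyComplex E] in
/-- `ᵗ(c • L) = c • ᵗL` (linearity of the transpose, Mathlib `Module.Dual.transpose`). [cite: SerreTate1968, §1 (contragredient)] -/
private theorem dualMap_smul {V W : Type*} [AddCommGroup V] [Module ℚ_[ℓ] V] [AddCommGroup W] [Module ℚ_[ℓ] W]
    (c : ℚ_[ℓ]) (L : V →ₗ[ℚ_[ℓ]] W) : (c • L).dualMap = c • L.dualMap :=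
  map_smul (Module.Dual.transpose (R := ℚ_[ℓ])) c L

omit [NumberField E] [IsTotallyComplex E] in
/-- **`ᵗV_ℓ(u) ∘ ᵗV_ℓ(v) = m` on `R ⊗ (V_ℓ B)^∨`** when `u ≫ v = [m]` (★ `rationalTateModuleMap_comp_of_comp_eq_nsmul`, dualised and
base-changed). [cite: MumfordAV1970, §19 (p. 172)] -/
theorem dualMap_baseChange_comp_of_comp_eq_nsmul {B B' : AbelianVariety E} {u : B ⟶ B'} {v : B' ⟶ B} {m : ℕ}
    (huv : u ≫ v = m • 𝟙 B) (R : Type) [CommRing R] [Algebra ℚ_[ℓ] R]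
    (f : R ⊗[ℚ_[ℓ]] Module.Dual ℚ_[ℓ] (B.rationalTateModule ℓ)) :
    ((rationalTateModuleMap ℓ u).dualMap).baseChange R (((rationalTateModuleMap ℓ v).dualMap).baseChange R f) =
      (m : ℚ_[ℓ]) • f := by
  have huv' : (rationalTateModuleMap ℓ u).dualMap ∘ₗ (rationalTateModuleMap ℓ v).dualMap =
      (m : ℚ_[ℓ]) • (LinearMap.id : Module.Dual ℚ_[ℓ] (B.rationalTateModule ℓ) →ₗ[ℚ_[ℓ]] _) := by
    rw [LinearMap.dualMap_comp_dualMap, AbelianVariety.rationalTateModuleMap_comp_of_comp_eq_nsmul ℓ huv,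
      ← Nat.cast_smul_eq_nsmul ℚ_[ℓ], dualMap_smul, LinearMap.dualMap_id]
  have := congrArg (fun (L : Module.Dual ℚ_[ℓ] (B.rationalTateModule ℓ) →ₗ[ℚ_[ℓ]] _) => (L.baseChange R) f) huv'
  simpa only [LinearMap.baseChange_comp, LinearMap.comp_apply, LinearMap.baseChange_smul, LinearMap.baseChange_id,
    LinearMap.smul_apply, LinearMap.id_apply] using this

omit [NumberField E] [IsTotallyComplex E] in
/-- **`V_ℓ` of the transport of `End⁰` along an isogeny pair** (`u ≫ v = [m]`, `v ≫ u = [m]`): for `y ∈ End⁰(B)`,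
`V_ℓ(End⁰(u)(y)) = m⁻¹ · V_ℓ(u) ∘ V_ℓ(y) ∘ V_ℓ(v)` on `V_ℓ B′` — `End⁰(u)(y) = m⁻¹ · (v ≫ y ≫ u)` ([MumfordAV1970] §19
p. 172, ★ `endAlgebraTransport_algebraMap_mul_of`) read through ★ `rationalTateAction`. [cite: MumfordAV1970, §19 (p. 172)] [cite: SerreTate1968, §4 (proof of Thm. 5)] -/
theorem rationalTateAction_endAlgebraTransport {B B' : AbelianVariety E} (u : B ⟶ B') (v : B' ⟶ B) (m : ℕ)
    (hm : 0 < m) (huv : u ≫ v = m • 𝟙 B) (hvu : v ≫ u = m • 𝟙 B') (y : B.endAlgebra) :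
    AbelianVariety.rationalTateAction B' ℓ (endAlgebraTransport u v m hm huv hvu y) =
      (m : ℚ_[ℓ])⁻¹ • (rationalTateModuleMap ℓ u ∘ₗ AbelianVariety.rationalTateAction B ℓ y ∘ₗ
        rationalTateModuleMap ℓ v) := by
  obtain ⟨M, F, hM, rfl⟩ := AbelianVariety.endAlgebra.exists_eq_algebraMap_mul_of y
  rw [AbelianVariety.endAlgebraTransport_algebraMap_mul_of,
    AbelianVariety.rationalTateAction_of_eq_algebraMap_mul_of B ℓ rfl, map_mul,
    AbelianVariety.rationalTateAction_algebraMap, AbelianVariety.rationalTateAction_of, ← Algebra.smul_def]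
  -- `endConj u v F = v ≫ F ≫ u` as a morphism, so `V_ℓ(endConj u v F) = V_ℓ u ∘ V_ℓ F ∘ V_ℓ v`
  have hconj : (rationalTateModuleMap ℓ (AbelianVariety.endConj u v F : B' ⟶ B') :
      B'.rationalTateModule ℓ →ₗ[ℚ_[ℓ]] B'.rationalTateModule ℓ) =
      rationalTateModuleMap ℓ u ∘ₗ rationalTateModuleMap ℓ (F : B ⟶ B) ∘ₗ rationalTateModuleMap ℓ v := by
    change rationalTateModuleMap ℓ (v ≫ (F : B ⟶ B) ≫ u) = _
    rw [AbelianVariety.rationalTateModuleMap_comp, AbelianVariety.rationalTateModuleMap_comp]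
    rfl
  rw [hconj]
  simp only [LinearMap.comp_smul, LinearMap.smul_comp, smul_smul, map_mul, map_inv₀, map_natCast, mul_comm]

omit [NumberField E] [IsTotallyComplex E] in
/-- **Transport of a dual eigenvector to the principal model.**  If `f ∈ R ⊗ (V_ℓ B)^∨` is an eigenvector of `1 ⊗ ᵗV_ℓ(y)`
(`y ∈ End⁰(B)`, rational action ★ `rationalTateAction`) with eigenvalue `c`, then `f′ := (1 ⊗ ᵗV_ℓ(v)) f ∈ R ⊗ (V_ℓ B′)^∨` is an
eigenvector of `1 ⊗ ᵗV_ℓ(End⁰(u)(y))` with the same eigenvalue (`ᵗV_ℓ(u) ᵗV_ℓ(v) = m`).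
[cite: MumfordAV1970, §19 (p. 172)] [cite: SerreTate1968, §4 (proof of Thm. 5)] -/
theorem dualMap_rationalTateAction_endAlgebraTransport_baseChange_eq_smul {B B' : AbelianVariety E} (u : B ⟶ B')
    (v : B' ⟶ B) (m : ℕ) (hm : 0 < m) (huv : u ≫ v = m • 𝟙 B) (hvu : v ≫ u = m • 𝟙 B') (y : B.endAlgebra)
    (R : Type) [CommRing R] [Algebra ℚ_[ℓ] R] (c : R) (f : R ⊗[ℚ_[ℓ]] Module.Dual ℚ_[ℓ] (B.rationalTateModule ℓ))
    (hf : ((AbelianVariety.rationalTateAction B ℓ y).dualMap).baseChange R f = c • f) :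
    ((AbelianVariety.rationalTateAction B' ℓ (endAlgebraTransport u v m hm huv hvu y)).dualMap).baseChange R
        (((rationalTateModuleMap ℓ v).dualMap).baseChange R f) =
      c • ((rationalTateModuleMap ℓ v).dualMap).baseChange R f := by
  have hm' : (m : ℚ_[ℓ]) ≠ 0 := Nat.cast_ne_zero.2 hm.ne'
  -- the transported operator, dualised: `m⁻¹ · ᵗV(v) ∘ ᵗV(y) ∘ ᵗV(u)`
  rw [rationalTateAction_endAlgebraTransport u v m hm huv hvu y, dualMap_smul, LinearMap.baseChange_smul]
  have hd : (rationalTateModuleMap ℓ u ∘ₗ AbelianVariety.rationalTateAction B ℓ y ∘ₗ rationalTateModuleMap ℓ v).dualMap =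
      (rationalTateModuleMap ℓ v).dualMap ∘ₗ (AbelianVariety.rationalTateAction B ℓ y).dualMap ∘ₗ
        (rationalTateModuleMap ℓ u).dualMap := by
    rw [LinearMap.dualMap_comp_dualMap, LinearMap.dualMap_comp_dualMap]
    rfl
  rw [hd, LinearMap.smul_apply, LinearMap.baseChange_comp, LinearMap.baseChange_comp, LinearMap.comp_apply,
    LinearMap.comp_apply, dualMap_baseChange_comp_of_comp_eq_nsmul (ℓ := ℓ) huv R f, LinearMap.map_smul_of_tower, hf,
    LinearMap.map_smul_of_tower, map_smul, inv_smul_smul₀ hm']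

/-- **The CM step of [Liu2021] Thm. D.6 (1) — `B`-side interface (no principal model in the statement).**  For a quotient
`φ : A_K ⟶ B` with a RATIONAL CM structure `i : M →+* End⁰_E(B)` of full degree by a CM field `M`: there is a family
`χ : (M →+* ℂ) → HeckeCharacter E` — the Shimura–Taniyama family of a principal model `(B′, ρ)` of `(B, i)` over `E`, of CM type
`Φ` (recorded in the first conjunct) — such that for all `w` outside a finite set (`ℓ ∤ w`), every `𝔓 ∣ w`, every arithmetic
Frobenius `σ` at `𝔓`, every field `R ⊇ ℚ_ℓ`, `ι′ : ℂ →+* R`, `τ : M →+* ℂ` and every `f ∈ R ⊗ (V_ℓ B)^∨` on the `(ι′ ∘ τ)`-eigenline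
of the RATIONAL action (`(1 ⊗ ᵗV_ℓ(i a)) f = ι′(τ a) • f` for all `a ∈ M`, ★ `rationalTateAction`):
`(1 ⊗ towerRep σ) ((1 ⊗ (toTower K ∘ ᵗV_ℓ φ)) f) = (ι′ (χ_τ(ϖ_w)))⁻¹ • (1 ⊗ (toTower K ∘ ᵗV_ℓ φ)) f`.
Proof: edition-1 head on `(B′, ρ)` applied to `f′ := (1 ⊗ ᵗV_ℓ(v)) f` (an eigenvector by the previous theorem), and
`ᵗV_ℓ(φ ≫ u) f′ = m • ᵗV_ℓ(φ) f`, `m ≠ 0`.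
[cite: Liu2021, App. D §D.4 (FJcycle.tex l. 5626–5628) and §4.2 (l. 2158–2165)] [cite: Shimura1998, §7.1 Proposition 7 (p. 47), Thm. 18.6, Thm. 19.11] [cite: SerreTate1968, §7 Thm. 10 (c), Thm. 11] -/
theorem exists_heckeCharacter_towerRep_eq_inv_smul_of_ringHom' [Algebra E ℂ] (C : Sec42Data P5 isotropicAt) (ℓ : ℕ)
    [Fact ℓ.Prime] (K : C5.SmallLevel C.S.K₀)
    {B : AbelianVariety E} (φ : C.A K ⟶ B) {M : Type} [Field M] [NumberField M] [IsCMField M]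
    (i : M →+* B.endAlgebra) (hdim : Module.finrank ℚ M = 2 * B.dim) :
    ∃ χ : (M →+* ℂ) → HeckeCharacter E,
      (∃ (B' : AbelianVariety E) (u : B ⟶ B') (v : B' ⟶ B) (m : ℕ) (hm : 0 < m) (huv : u ≫ v = m • 𝟙 B)
        (hvu : v ≫ u = m • 𝟙 B') (ρ : 𝓞 M →+* End B') (Φ : CMType M),
        IsIsogeny u ∧ (∀ a : 𝓞 M, endAlgebraTransport u v m hm huv hvu (i (a : M)) = AbelianVariety.endAlgebra.of B' (ρ a)) ∧
        IsCMTypeRealisationOver Φ B' ρ ∧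
        ∀ τ : M →+* ℂ, (χ τ).HasInfinityType (cmInfinityType Φ.1 τ (algebraMap E ℂ)).1
          (cmInfinityType Φ.1 τ (algebraMap E ℂ)).2) ∧
      (∀ᶠ w : HeightOneSpectrum (𝓞 E) in Filter.cofinite, (ℓ : 𝓞 E) ∉ w.asIdeal →
        ∀ 𝔓 ∈ w.primesAbove, ∀ σ : Field.absoluteGaloisGroup E, IsArithFrobAt (𝓞 E) σ 𝔓 →
          ∀ (R : Type) [Field R] [Algebra ℚ_[ℓ] R] (ι' : ℂ →+* R) (τ : M →+* ℂ)
            (f : R ⊗[ℚ_[ℓ]] Module.Dual ℚ_[ℓ] (B.rationalTateModule ℓ)),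
            (∀ a : M, ((AbelianVariety.rationalTateAction B ℓ (i a)).dualMap).baseChange R f = ι' (τ a) • f) →
            (C.towerRep ℓ σ).baseChange R ((C.toTower ℓ K ∘ₗ (rationalTateModuleMap ℓ φ).dualMap).baseChange R f) =
              (ι' ((χ τ).valueAtUniformizer w))⁻¹ •
                (C.toTower ℓ K ∘ₗ (rationalTateModuleMap ℓ φ).dualMap).baseChange R f) := by
  obtain ⟨B', u, v, m, hm, huv, hvu, ρ, Φ, χ, hu, hρ, hΦ, h1, h5⟩ :=
    C.exists_heckeCharacter_towerRep_eq_inv_smul_of_ringHom ℓ K φ i hdim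
  refine ⟨χ, ⟨B', u, v, m, hm, huv, hvu, ρ, Φ, hu, hρ, hΦ, h1⟩, ?_⟩
  filter_upwards [h5] with w hw
  intro hℓ 𝔓 h𝔓 σ hσ R _ _ ι' τ f hf
  have hm' : (m : ℚ_[ℓ]) ≠ 0 := Nat.cast_ne_zero.2 hm.ne'
  -- the transported eigenvector `f′ := (1 ⊗ ᵗV(v)) f` on the principal model is a `ρ`-eigenvector
  have hf' : ∀ x : 𝓞 M, ((rationalTateModuleMap ℓ (ρ x : B' ⟶ B')).dualMap).baseChange R
      (((rationalTateModuleMap ℓ v).dualMap).baseChange R f) =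
      ι' (τ (x : M)) • ((rationalTateModuleMap ℓ v).dualMap).baseChange R f := by
    intro x
    have hx := dualMap_rationalTateAction_endAlgebraTransport_baseChange_eq_smul (ℓ := ℓ) u v m hm huv hvu (i (x : M)) R
      (ι' (τ (x : M))) f (hf (x : M))
    rwa [hρ x, AbelianVariety.rationalTateAction_of] at hx
  have key := hw hℓ 𝔓 h𝔓 σ hσ R ι' τ _ hf'
  -- the class of `f′` along `φ ≫ u` is `m •` the class of `f` along `φ`
  have hcomp : C.toTower ℓ K ∘ₗ (rationalTateModuleMap ℓ (φ ≫ u)).dualMap =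
      (C.toTower ℓ K ∘ₗ (rationalTateModuleMap ℓ φ).dualMap) ∘ₗ (rationalTateModuleMap ℓ u).dualMap := by
    rw [AbelianVariety.rationalTateModuleMap_comp, ← LinearMap.dualMap_comp_dualMap]
    rfl
  rw [hcomp, LinearMap.baseChange_comp, LinearMap.comp_apply, dualMap_baseChange_comp_of_comp_eq_nsmul (ℓ := ℓ) huv R f,
    LinearMap.map_smul_of_tower, LinearMap.map_smul_of_tower, smul_comm _ (m : ℚ_[ℓ])] at key
  have := congrArg (fun z => (m : ℚ_[ℓ])⁻¹ • z) key
  simpa only [inv_smul_smul₀ hm'] using this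

end BSide

end Sec42Data

end Literature.NumberTheory.Automorphic.Liu2021.AppendixC

end
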